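import Mathlib.RingTheory.Polynomial.Pochhammer
import Mathlib.Algebra.Polynomial.Derivative
import Mathlib.Algebra.Polynomial.BigOperators
import Mathlib.Data.Real.Basic
import Mathlib.Tactic.FieldSimp
import Mathlib.Tactic.LinearCombination
import Mathlib.Tactic.Positivity
import Mathlib.Tactic.Ring
import HarnessLib

/-!
# Generalized Laguerre polynomials `L_n^{(α)}`

Mathlib has no Laguerre polynomials; this file defines the generalized (associated) Laguerre
polynomial `L_n^{(α)} ∈ ℝ[X]` for a real parameter `α` by its explicit hypergeometric expansion

  `L_n^{(α)}(x) = ∑_{k=0}^{n} (−1)^k (α+k+1)_{n−k} / ((n−k)! k!) · x^k = ∑_{k=0}^{n} binom(n+α, n−k) (−x)^k / k!`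

(`(a)_m = a(a+1)⋯(a+m−1)` the rising factorial, Mathlib's `ascPochhammer`), i.e.
`L_n^{(α)}(x) = ((α+1)_n / n!) · ₁F₁(−n; α+1; x)` [Szegő (5.1.6), (5.3.3); DLMF 18.5.12], and proves
the algebraic identities used downstream (no orthogonality, no analysis):

* `coeff_laguerre`, `natDegree_laguerre`, `leadingCoeff_laguerre` (`= (−1)^n/n!`), `laguerre_zero`,
  `laguerre_one` (`= α + 1 − X`), `eval_zero_laguerre` (`L_n^{(α)}(0) = (α+1)_n/n!` [Szegő (5.1.7)]);
* `laguerre_coeff_rel` : the coefficient recursion `(k+1)(k+α+1) c_{k+1} + (n−k) c_k = 0`;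
* `laguerre_ode` : **Laguerre's differential equation** `x y″ + (α+1−x) y′ + n y = 0`,
  `y = L_n^{(α)}` [Szegő (5.1.2), first equation], as a polynomial identity;
* `laguerre_three_term` : the three-term recurrence `(n+1) L_{n+1}^{(α)} = (2n+1+α−x) L_n^{(α)} − (n+α) L_{n−1}^{(α)}`
  [Szegő (5.1.10)];
* `derivative_laguerre_succ` : `(L_{n+1}^{(α)})′ = −L_n^{(α+1)}` [DLMF 18.9.23]; `laguerre_two`.

## References
* [Szego1975] G. Szegő, *Orthogonal Polynomials*, AMS Colloq. Publ. 23, 4th ed. (1975), §5.1: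
  (5.1.2) (differential equations), (5.1.6) (explicit representation), (5.1.7) (`L_n^{(α)}(0)`),
  (5.1.10) (three-term recurrence);
  §5.3: (5.3.3) (`L_n^{(α)}(x) = binom(n+α, n) ₁F₁(−n; α+1; x)`).
* [DLMF] NIST Digital Library of Mathematical Functions, 18.5.12.
-/

open Polynomial Finset
open scoped Nat

namespace Literature.Analysis.SpecialFunctions

noncomputable section

/-! ### Rising factorials: two evaluation identities -/

/-- `(a)_{m+1} = a · (a+1)_m`. [cite: DLMF, 5.2.5] -/
theorem ascPochhammer_eval_succ_left (m : ℕ) (a : ℝ) :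
    (ascPochhammer ℝ (m + 1)).eval a = a * (ascPochhammer ℝ m).eval (a + 1) := by
  rw [ascPochhammer_succ_left, eval_mul, eval_X, eval_comp, eval_add, eval_X, eval_one]

/-- `(a)_j · (a+j)_m = (a)_{j+m}`. [cite: DLMF, 5.2.5] -/
theorem ascPochhammer_eval_mul_eval_add (j m : ℕ) (a : ℝ) :
    (ascPochhammer ℝ j).eval a * (ascPochhammer ℝ m).eval (a + j) = (ascPochhammer ℝ (j + m)).eval a := by
  rw [← ascPochhammer_mul, eval_mul, eval_comp, eval_add, eval_X, eval_natCast]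

/-- `(a)_{m+1} = (a)_m · (a + m)`. [cite: DLMF, 5.2.5] -/
theorem ascPochhammer_eval_succ_right (m : ℕ) (a : ℝ) :
    (ascPochhammer ℝ (m + 1)).eval a = (ascPochhammer ℝ m).eval a * (a + m) := by
  rw [ascPochhammer_succ_eval]

/-- `(a)_m > 0` for `a > 0`. [cite: DLMF, 5.2.5] -/
theorem ascPochhammer_eval_pos {a : ℝ} (ha : 0 < a) (m : ℕ) : 0 < (ascPochhammer ℝ m).eval a :=
  ascPochhammer_pos m a ha

/-! ### Definition and coefficients -/

/-- The `k`-th coefficient of `L_n^{(α)}`: `(−1)^k (α+k+1)_{n−k} / ((n−k)! k!) = binom(n+α, n−k)(−1)^k/k!`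
(meaningful for `k ≤ n`). [cite: Szego1975, (5.1.6)] -/
def laguerreCoeff (α : ℝ) (n k : ℕ) : ℝ :=
  (-1) ^ k * (ascPochhammer ℝ (n - k)).eval (α + k + 1) / (((n - k)! : ℝ) * (k ! : ℝ))

/-- The **generalized Laguerre polynomial** `L_n^{(α)}(X) = ∑_{k ≤ n} (−1)^k (α+k+1)_{n−k}/((n−k)! k!) X^k`
(real parameter `α`; for `α > −1` these are the polynomials orthogonal for `e^{−x}x^α dx` on `(0, ∞)`
with Szegő's normalisation (5.1.1), a fact not used or proved here). [cite: Szego1975, (5.1.6)] -/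
def laguerre (α : ℝ) (n : ℕ) : ℝ[X] :=
  ∑ k ∈ range (n + 1), C (laguerreCoeff α n k) * X ^ k

/-- Coefficients of `L_n^{(α)}`. [cite: Szego1975, (5.1.6)] -/
theorem coeff_laguerre (α : ℝ) (n k : ℕ) :
    (laguerre α n).coeff k = if k ≤ n then laguerreCoeff α n k else 0 := by
  rw [laguerre, finsetSum_coeff]
  simp only [coeff_C_mul_X_pow]
  rw [Finset.sum_ite_eq (range (n + 1)) k (fun j => laguerreCoeff α n j)]
  simp [Finset.mem_range]

/-- Coefficients of `L_n^{(α)}` in range. [cite: Szego1975, (5.1.6)] -/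
theorem coeff_laguerre_of_le (α : ℝ) {n k : ℕ} (h : k ≤ n) :
    (laguerre α n).coeff k = laguerreCoeff α n k := by
  rw [coeff_laguerre, if_pos h]

/-- Coefficients of `L_n^{(α)}` beyond the degree vanish. [cite: Szego1975, (5.1.6)] -/
theorem coeff_laguerre_of_lt (α : ℝ) {n k : ℕ} (h : n < k) :
    (laguerre α n).coeff k = 0 := by
  rw [coeff_laguerre, if_neg (not_le.mpr h)]

/-- Evaluation of `L_n^{(α)}` as a finite sum. [cite: Szego1975, (5.1.6)] -/
theorem eval_laguerre (α : ℝ) (n : ℕ) (x : ℝ) :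
    (laguerre α n).eval x = ∑ k ∈ range (n + 1), laguerreCoeff α n k * x ^ k := by
  simp [laguerre, eval_finsetSum]

/-- The top coefficient: `c_n = (−1)^n / n!`. [cite: Szego1975, (5.1.6)] -/
theorem laguerreCoeff_self (α : ℝ) (n : ℕ) : laguerreCoeff α n n = (-1) ^ n / (n ! : ℝ) := by
  simp [laguerreCoeff]

/-- `L_n^{(α)}` has degree `n`. [cite: Szego1975, (5.1.6)] -/
theorem natDegree_laguerre (α : ℝ) (n : ℕ) : (laguerre α n).natDegree = n := by
  apply le_antisymm
  · apply natDegree_sum_le_of_forall_le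
    intro j hj
    refine (natDegree_C_mul_X_pow_le _ _).trans ?_
    simpa [Nat.lt_succ_iff] using hj
  · apply le_natDegree_of_ne_zero
    rw [coeff_laguerre_of_le α le_rfl, laguerreCoeff_self]
    have : (n ! : ℝ) ≠ 0 := by positivity
    exact div_ne_zero (pow_ne_zero _ (by norm_num)) this

/-- The leading coefficient of `L_n^{(α)}` is `(−1)^n/n!` (sign `(−1)^n`, Szegő's normalisation).
[cite: Szego1975, (5.1.6)] -/
theorem leadingCoeff_laguerre (α : ℝ) (n : ℕ) :
    (laguerre α n).leadingCoeff = (-1) ^ n / (n ! : ℝ) := by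
  rw [leadingCoeff, natDegree_laguerre, coeff_laguerre_of_le α le_rfl, laguerreCoeff_self]

/-- `L_n^{(α)} ≠ 0`. [cite: Szego1975, (5.1.6)] -/
theorem laguerre_ne_zero (α : ℝ) (n : ℕ) : laguerre α n ≠ 0 := by
  intro h
  have := leadingCoeff_laguerre α n
  rw [h, leadingCoeff_zero] at this
  have hn : (n ! : ℝ) ≠ 0 := by positivity
  exact (div_ne_zero (pow_ne_zero n (by norm_num : (-1 : ℝ) ≠ 0)) hn) this.symm

/-- `L_0^{(α)} = 1`. [cite: Szego1975, (5.1.6)] -/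
@[simp]
theorem laguerre_zero (α : ℝ) : laguerre α 0 = 1 := by
  simp [laguerre, laguerreCoeff]

/-- `L_1^{(α)} = α + 1 − X`. [cite: Szego1975, (5.1.6)] -/
theorem laguerre_one (α : ℝ) : laguerre α 1 = C (α + 1) - X := by
  simp [laguerre, laguerreCoeff, Finset.sum_range_succ, ascPochhammer_one, sub_eq_add_neg]

/-- `L_n^{(α)}(0) = (α+1)_n / n! = binom(n+α, n)`. [cite: Szego1975, (5.1.7)] -/
theorem eval_zero_laguerre (α : ℝ) (n : ℕ) :
    (laguerre α n).eval 0 = (ascPochhammer ℝ n).eval (α + 1) / (n ! : ℝ) := by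
  rw [← coeff_zero_eq_eval_zero, coeff_laguerre_of_le α (Nat.zero_le n)]
  simp [laguerreCoeff]

/-! ### The coefficient recursion and Laguerre's differential equation -/

/-- The coefficient recursion of `L_n^{(α)}`: `(k+1)(k+α+1)·c_{k+1} + (n−k)·c_k = 0` for `k + 1 ≤ n`
(ratio of consecutive terms of `₁F₁(−n; α+1; x)`). [cite: Szego1975, (5.3.3)] -/
theorem laguerreCoeff_rel (α : ℝ) {n k : ℕ} (h : k + 1 ≤ n) :
    ((k : ℝ) + 1) * (α + k + 1) * laguerreCoeff α n (k + 1) + ((n : ℝ) - k) * laguerreCoeff α n k = 0 := by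
  obtain ⟨m, hm⟩ : ∃ m, n - (k + 1) = m := ⟨_, rfl⟩
  have hm' : n - k = m + 1 := by omega
  have hnk : ((n : ℝ) - k) = (m : ℝ) + 1 := by
    have : n = m + 1 + k := by omega
    subst this
    push_cast
    ring
  rw [laguerreCoeff, laguerreCoeff, hm, hm', hnk, ascPochhammer_eval_succ_left]
  have e1 : (α + ↑k + 1 + 1 : ℝ) = α + ↑(k + 1) + 1 := by push_cast; ring
  rw [← e1]
  have hmf : ((m + 1)! : ℝ) = ((m : ℝ) + 1) * (m ! : ℝ) := by
    rw [Nat.factorial_succ]; push_cast; ring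
  have hkf : ((k + 1)! : ℝ) = ((k : ℝ) + 1) * (k ! : ℝ) := by
    rw [Nat.factorial_succ]; push_cast; ring
  rw [hmf, hkf, pow_succ]
  have h1 : (m ! : ℝ) ≠ 0 := by positivity
  have h2 : (k ! : ℝ) ≠ 0 := by positivity
  have h3 : ((m : ℝ) + 1) ≠ 0 := by positivity
  have h4 : ((k : ℝ) + 1) ≠ 0 := by positivity
  field_simp
  ring

/-- The coefficient recursion stated on the polynomial's coefficients, valid for every `k`
(both sides vanish beyond the degree). [cite: Szego1975, (5.3.3)] -/
theorem laguerre_coeff_rel (α : ℝ) (n k : ℕ) :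
    ((k : ℝ) + 1) * (α + k + 1) * (laguerre α n).coeff (k + 1)
      + ((n : ℝ) - k) * (laguerre α n).coeff k = 0 := by
  rcases lt_trichotomy (k + 1) (n + 1) with h | h | h
  · -- k + 1 ≤ n
    have hk : k + 1 ≤ n := by omega
    rw [coeff_laguerre_of_le α hk, coeff_laguerre_of_le α (by omega : k ≤ n)]
    exact laguerreCoeff_rel α hk
  · -- k = n
    have hk : k = n := by omega
    subst hk
    rw [coeff_laguerre_of_lt α (Nat.lt_succ_self k)]
    simp
  · -- k > n
    rw [coeff_laguerre_of_lt α (by omega : n < k + 1), coeff_laguerre_of_lt α (by omega : n < k)]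
    simp

/-- **Laguerre's differential equation** [Szegő (5.1.2), first equation]: as an identity in `ℝ[X]`,
`X · L″ + (α + 1 − X) · L′ + n · L = 0` for `L = L_n^{(α)}`. [cite: Szego1975, (5.1.2)] -/
theorem laguerre_ode (α : ℝ) (n : ℕ) :
    X * derivative (derivative (laguerre α n)) + (C (α + 1) - X) * derivative (laguerre α n)
      + C (n : ℝ) * laguerre α n = 0 := by
  ext k
  rw [sub_mul, coeff_add, coeff_add, coeff_sub, coeff_C_mul, coeff_C_mul, coeff_zero]
  rcases k with _ | j
  · rw [coeff_X_mul_zero, coeff_X_mul_zero, coeff_derivative]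
    have h := laguerre_coeff_rel α n 0
    push_cast at h ⊢
    linear_combination h
  · rw [coeff_X_mul, coeff_X_mul]
    simp only [coeff_derivative]
    have h := laguerre_coeff_rel α n (j + 1)
    push_cast at h ⊢
    linear_combination h

/-- Laguerre's differential equation evaluated at a point:
`x·L″(x) + (α+1−x)·L′(x) + n·L(x) = 0`. [cite: Szego1975, (5.1.2)] -/
theorem laguerre_ode_eval (α : ℝ) (n : ℕ) (x : ℝ) :
    x * (derivative (derivative (laguerre α n))).eval x
      + (α + 1 - x) * (derivative (laguerre α n)).eval x + n * (laguerre α n).eval x = 0 := by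
  have h := congrArg (fun p => p.eval x) (laguerre_ode α n)
  simpa [eval_add, eval_mul, eval_sub, eval_X, eval_C] using h

/-- The sign-flipped polynomial `L_n^{(α)}(−X) = ∑_{k ≤ n} (α+k+1)_{n−k}/((n−k)! k!) X^k` has the
positive coefficients `binom(n+α, n−k)/k!` (for `α > −1`). [cite: Szego1975, (5.1.6)] -/
theorem coeff_laguerre_comp_neg_X (α : ℝ) {n k : ℕ} (h : k ≤ n) :
    ((laguerre α n).comp (-X)).coeff k
      = (ascPochhammer ℝ (n - k)).eval (α + k + 1) / (((n - k)! : ℝ) * (k ! : ℝ)) := by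
  rw [laguerre, Polynomial.sum_comp]
  simp only [mul_comp, C_comp, X_pow_comp, finsetSum_coeff]
  have hterm : ∀ j ∈ range (n + 1), ((C (laguerreCoeff α n j) * (-X) ^ j : ℝ[X])).coeff k
      = if k = j then (ascPochhammer ℝ (n - k)).eval (α + k + 1) / (((n - k)! : ℝ) * (k ! : ℝ)) else 0 := by
    intro j _
    have hCX : (C (laguerreCoeff α n j) * (-X) ^ j : ℝ[X]) = C (laguerreCoeff α n j * (-1) ^ j) * X ^ j := by
      rw [neg_pow, map_mul, map_pow, map_neg, map_one, mul_assoc]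
    rw [hCX, coeff_C_mul_X_pow]
    split_ifs with hkj
    · subst hkj
      rw [laguerreCoeff]
      have : ((-1 : ℝ) ^ k) * ((-1 : ℝ) ^ k) = 1 := by
        rw [← mul_pow]; norm_num
      have hD : (((n - k)! : ℝ) * (k ! : ℝ)) ≠ 0 := by positivity
      field_simp
      linear_combination ((ascPochhammer ℝ (n - k)).eval (α + k + 1)) * this
    · rfl
  rw [Finset.sum_congr rfl hterm, Finset.sum_ite_eq]
  simp [Finset.mem_range, Nat.lt_succ_of_le h]

/-! ### The three-term recurrence -/

/-- **Three-term recurrence** [Szegő (5.1.10)]: `(n+1) L_{n+1}^{(α)} = (2n+1+α−X) L_n^{(α)} − (n+α) L_{n−1}^{(α)}`,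
stated with `n + 1` in place of `n`:
`(n+2) L_{n+2}^{(α)} = (2n+3+α−X) L_{n+1}^{(α)} − (n+1+α) L_n^{(α)}`. [cite: Szego1975, (5.1.10)] -/
theorem laguerre_three_term (α : ℝ) (n : ℕ) :
    C ((n : ℝ) + 2) * laguerre α (n + 2)
      = (C (2 * n + 3 + α) - X) * laguerre α (n + 1) - C ((n : ℝ) + 1 + α) * laguerre α n := by
  ext k
  rw [coeff_C_mul, sub_mul, coeff_sub, coeff_sub, coeff_C_mul, coeff_C_mul]
  -- the `X * L_{n+1}` coefficient
  have hX : ∀ k, (X * laguerre α (n + 1)).coeff k = if k = 0 then 0 else (laguerre α (n + 1)).coeff (k - 1) := by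
    intro k
    rcases k with _ | j
    · simp
    · simp [coeff_X_mul]
  rw [hX]
  rcases Nat.lt_or_ge (n + 2) k with hk | hk
  · -- k > n + 2: everything vanishes
    rw [coeff_laguerre_of_lt α hk, coeff_laguerre_of_lt α (by omega : n + 1 < k),
      coeff_laguerre_of_lt α (by omega : n < k), if_neg (by omega : k ≠ 0),
      coeff_laguerre_of_lt α (by omega : n + 1 < k - 1)]
    ring
  rcases Nat.lt_or_ge (n + 1) k with hk1 | hk1
  · -- k = n + 2
    have hk2 : k = n + 2 := by omega
    subst hk2
    rw [coeff_laguerre_of_le α le_rfl, coeff_laguerre_of_lt α (by omega : n + 1 < n + 2),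
      coeff_laguerre_of_lt α (by omega : n < n + 2), if_neg (by omega : n + 2 ≠ 0),
      show n + 2 - 1 = n + 1 by omega, coeff_laguerre_of_le α le_rfl, laguerreCoeff_self,
      laguerreCoeff_self]
    have hf : ((n + 2)! : ℝ) = ((n : ℝ) + 2) * ((n + 1)! : ℝ) := by
      rw [Nat.factorial_succ (n + 1)]; push_cast; ring
    rw [hf, pow_succ]
    have h1 : ((n + 1)! : ℝ) ≠ 0 := by positivity
    have h2 : ((n : ℝ) + 2) ≠ 0 := by positivity
    field_simp
    ring
  rcases Nat.lt_or_ge n k with hk0 | hk0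
  · -- k = n + 1
    have hk2 : k = n + 1 := by omega
    subst hk2
    rw [coeff_laguerre_of_le α (by omega : n + 1 ≤ n + 2), coeff_laguerre_of_le α le_rfl,
      coeff_laguerre_of_lt α (by omega : n < n + 1), if_neg (by omega : n + 1 ≠ 0),
      show n + 1 - 1 = n by omega, coeff_laguerre_of_le α (by omega : n ≤ n + 1),
      laguerreCoeff, laguerreCoeff, laguerreCoeff,
      show n + 2 - (n + 1) = 1 by omega, show n + 1 - (n + 1) = 0 by omega,
      show n + 1 - n = 1 by omega, ascPochhammer_one, eval_X, eval_X, ascPochhammer_zero, eval_one]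
    have hf : ((n + 1)! : ℝ) = ((n : ℝ) + 1) * (n ! : ℝ) := by
      rw [Nat.factorial_succ]; push_cast; ring
    rw [hf, pow_succ]
    have h1 : (n ! : ℝ) ≠ 0 := by positivity
    have h2 : ((n : ℝ) + 1) ≠ 0 := by positivity
    simp only [Nat.factorial_zero, Nat.factorial_one, Nat.cast_one]
    push_cast
    field_simp
    ring
  · -- k ≤ n : the generic case
    rcases k with _ | j
    · -- k = 0
      rw [if_pos rfl, sub_zero, coeff_laguerre_of_le α (by omega : 0 ≤ n + 2),
        coeff_laguerre_of_le α (by omega : 0 ≤ n + 1), coeff_laguerre_of_le α (by omega : 0 ≤ n),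
        laguerreCoeff, laguerreCoeff, laguerreCoeff, Nat.sub_zero, Nat.sub_zero, Nat.sub_zero,
        ascPochhammer_eval_succ_right (n + 1), ascPochhammer_eval_succ_right n]
      have hf1 : ((n + 1)! : ℝ) = ((n : ℝ) + 1) * (n ! : ℝ) := by
        rw [Nat.factorial_succ]; push_cast; ring
      have hf2 : ((n + 2)! : ℝ) = ((n : ℝ) + 2) * (((n : ℝ) + 1) * (n ! : ℝ)) := by
        rw [Nat.factorial_succ (n + 1)]; push_cast; rw [hf1]; ring
      rw [hf1, hf2]
      have h1 : (n ! : ℝ) ≠ 0 := by positivity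
      have h2 : ((n : ℝ) + 1) ≠ 0 := by positivity
      have h3 : ((n : ℝ) + 2) ≠ 0 := by positivity
      push_cast
      field_simp
      ring
    · -- k = j + 1 ≤ n
      obtain ⟨m, hm⟩ : ∃ m, n = m + j + 1 := ⟨n - j - 1, by omega⟩
      subst hm
      rw [if_neg (by omega : j + 1 ≠ 0), show j + 1 - 1 = j by omega,
        coeff_laguerre_of_le α (by omega : j + 1 ≤ m + j + 1 + 2),
        coeff_laguerre_of_le α (by omega : j + 1 ≤ m + j + 1 + 1),
        coeff_laguerre_of_le α (by omega : j ≤ m + j + 1 + 1),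
        coeff_laguerre_of_le α (by omega : j + 1 ≤ m + j + 1),
        laguerreCoeff, laguerreCoeff, laguerreCoeff, laguerreCoeff,
        show m + j + 1 + 2 - (j + 1) = m + 1 + 1 by omega,
        show m + j + 1 + 1 - (j + 1) = m + 1 by omega,
        show m + j + 1 + 1 - j = m + 1 + 1 by omega,
        show m + j + 1 - (j + 1) = m by omega]
      -- express everything via P = (α+j+2)_m
      rw [ascPochhammer_eval_succ_right (m + 1) (α + ↑(j + 1) + 1),
        ascPochhammer_eval_succ_right m (α + ↑(j + 1) + 1),
        ascPochhammer_eval_succ_left (m + 1) (α + ↑j + 1),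
        ascPochhammer_eval_succ_right m]
      have e1 : (α + ↑j + 1 + 1 : ℝ) = α + ↑(j + 1) + 1 := by push_cast; ring
      rw [e1]
      have hf1 : ((m + 1)! : ℝ) = ((m : ℝ) + 1) * (m ! : ℝ) := by
        rw [Nat.factorial_succ]; push_cast; ring
      have hf2 : ((m + 1 + 1)! : ℝ) = ((m : ℝ) + 2) * (((m : ℝ) + 1) * (m ! : ℝ)) := by
        rw [Nat.factorial_succ (m + 1)]; push_cast; rw [hf1]; ring
      have hf3 : ((j + 1)! : ℝ) = ((j : ℝ) + 1) * (j ! : ℝ) := by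
        rw [Nat.factorial_succ]; push_cast; ring
      rw [hf1, hf2, hf3, pow_succ]
      have h1 : (m ! : ℝ) ≠ 0 := by positivity
      have h2 : ((m : ℝ) + 1) ≠ 0 := by positivity
      have h3 : ((m : ℝ) + 2) ≠ 0 := by positivity
      have h4 : (j ! : ℝ) ≠ 0 := by positivity
      have h5 : ((j : ℝ) + 1) ≠ 0 := by positivity
      push_cast
      field_simp
      ring

/-! ### The derivative lowers the degree and raises the parameter -/

/-- `(L_n^{(α)})′ = −L_{n−1}^{(α+1)}` [DLMF 18.9.23], here for `n + 1` in place of `n`: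
`derivative (L_{n+1}^{(α)}) = −L_n^{(α+1)}`. [cite: DLMF, 18.9.23] -/
theorem derivative_laguerre_succ (α : ℝ) (n : ℕ) :
    derivative (laguerre α (n + 1)) = -laguerre (α + 1) n := by
  ext k
  rw [coeff_derivative, coeff_neg]
  rcases Nat.lt_or_ge n k with hk | hk
  · rw [coeff_laguerre_of_lt α (by omega : n + 1 < k + 1), coeff_laguerre_of_lt (α + 1) hk]
    simp
  · rw [coeff_laguerre_of_le α (by omega : k + 1 ≤ n + 1), coeff_laguerre_of_le (α + 1) hk,
      laguerreCoeff, laguerreCoeff]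
    have e1 : n + 1 - (k + 1) = n - k := by omega
    rw [e1]
    have hkf : ((k + 1)! : ℝ) = ((k : ℝ) + 1) * (k ! : ℝ) := by
      rw [Nat.factorial_succ]; push_cast; ring
    rw [hkf, pow_succ]
    have h2 : (k ! : ℝ) ≠ 0 := by positivity
    have h3 : ((n - k)! : ℝ) ≠ 0 := by positivity
    have h4 : ((k : ℝ) + 1) ≠ 0 := by positivity
    have e2 : (α + ↑(k + 1) + 1 : ℝ) = α + 1 + ↑k + 1 := by push_cast; ring
    rw [e2]
    field_simp

/-- `L_2^{(α)} = ((α+1)(α+2) − 2(α+2)X + X²)/2`. [cite: Szego1975, (5.1.6)] -/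
theorem laguerre_two (α : ℝ) :
    laguerre α 2 = C ((α + 1) * (α + 2) / 2) - C (α + 2) * X + C (1 / 2) * X ^ 2 := by
  have h0 : laguerreCoeff α 2 0 = (α + 1) * (α + 2) / 2 := by
    rw [laguerreCoeff, show 2 - 0 = 1 + 1 from rfl, ascPochhammer_eval_succ_left, ascPochhammer_one,
      eval_X, show (1 + 1)! = 2 from rfl, Nat.factorial_zero]
    push_cast
    ring
  have h1 : laguerreCoeff α 2 1 = -(α + 2) := by
    have e : laguerreCoeff α 2 1 = (-1) ^ 1 * (ascPochhammer ℝ 1).eval (α + 1 + 1) / (((1)! : ℝ) * ((1)! : ℝ)) := by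
      rw [laguerreCoeff]; norm_num
    rw [e, ascPochhammer_one, eval_X, Nat.factorial_one]
    push_cast
    ring
  have h2 : laguerreCoeff α 2 2 = 1 / 2 := by
    rw [laguerreCoeff, show 2 - 2 = 0 from rfl, ascPochhammer_zero, eval_one]
    norm_num [Nat.factorial]
  rw [laguerre, Finset.sum_range_succ, Finset.sum_range_succ, Finset.sum_range_succ,
    Finset.sum_range_zero, h0, h1, h2, zero_add, pow_zero, mul_one, pow_one, map_neg, neg_mul,
    ← sub_eq_add_neg]

end

end Literature.Analysis.SpecialFunctions
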